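import Literature.Analysis.Complex.PlancherelPolyaProofs
import Literature.Analysis.DeBrangesSpaces.HardyPaleyWiener
import Literature.Analysis.Fourier.FourierUniquenessL1
import Literature.Analysis.Fourier.FourierCompactSupportAnalytic
import HarnessLib

/-!
# The Paley–Wiener theorem for entire functions of exponential type

Topic `Literature/Analysis/Complex` (support file: theorems only — no definition, no named fact).

**Theorem (Paley–Wiener 1934; Rudin, *Real and Complex Analysis*, Thm. 19.3; Young 2001, Ch. 2
Thm. 18; Boas, *Entire Functions*, §6.8).** Let `F` be an entire function of exponential type
at most `τ ≥ 0` (the tree's `Literature.Analysis.Complex.IsEntireOfExpTypeLE F τ`: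
`‖F(z)‖ ≤ A_ε e^{(τ+ε)‖z‖}` for every `ε > 0`) whose restriction to the real axis is square
integrable. Then there is `φ ∈ L¹ ∩ L²(ℝ)` vanishing off `[−τ, τ]` with

  `F(z) = ∫ φ(u) e^{izu} du = ∫_{[−τ,τ]} φ(u) e^{izu} du`   for every `z ∈ ℂ`

(`paleyWiener_of_isEntireOfExpTypeLE`, `paleyWiener_of_isEntireOfExpTypeLE'`). Only this
direction is proved here (the converse is elementary).

## Proof (assembled from tree theorems; no contour shifting is redone)

1. Plancherel–Pólya (`Young2001_thm_2_16_PlancherelPolya_holds`, PROVED in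
   `PlancherelPolyaProofs.lean`): `∫ |F(x+iy)|² dx ≤ e^{2τ|y|} ∫ |F(x)|² dx` for every real `y`.
2. Hence `G(z) := F(z − i) e^{iτz}` is holomorphic on the upper half-plane with
   `∫ |G(x+iy)|² dx ≤ e^{2τ} ∫|F|²` for all `y > 0`, and the tree's Paley–Wiener theorem for
   `H²(ℂ₊)` (`Literature.Analysis.DeBrangesSpaces.exists_halfLine_laplace_of_hardy`, Rudin 19.2)
   writes `G(w) = ∫₀^∞ ψ(x) e^{iwx} dx` (`Im w > 0`) with `ψ ∈ L²(0, ∞)`. At `w = x + i` this is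
   `F(x) = ∫_{−τ}^{∞} ψ(v+τ) e^{−v} e^{ixv} dv`: on the real axis `F` is the Fourier integral of
   an `L¹ ∩ L²` density `A` supported in `[−τ, ∞)` (`exists_density_Ioi`).
3. The same applied to `F♯(z) = conj F(z̄)` and conjugated back gives a density `C` supported in
   `(−∞, τ]` with `F(x) = ∫ C(u) e^{ixu} du` (`exists_density_Iio`).
4. `A − C ∈ L¹` has identically vanishing Fourier transform, so `A = C` a.e.
   (`Literature.Analysis.Fourier.ae_eq_zero_of_forall_fourier_eq_zero`): the density lives on
   `[−τ, τ]`.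
5. Both sides of the final identity are entire (`differentiable_fourierLaplace` for the
   right-hand side) and agree on `ℝ`, hence everywhere.

This route (Plancherel–Pólya + `H²` of a half-plane + `L¹` uniqueness) replaces Rudin's contour
argument; it is the case `p = 2` of Boas §6.8.

## References

* [Rudin1987] W. Rudin, *Real and Complex Analysis*, 3rd ed., Thm. 19.3 (and 19.2).
* [Young2001Nonharmonic] R. M. Young, *An Introduction to Nonharmonic Fourier Series*, revised
  1st ed., Academic Press 2001, Ch. 2 Thm. 18 (Paley–Wiener), Thm. 16 (Plancherel–Pólya).
* [Boas1954] R. P. Boas, *Entire Functions*, Academic Press 1954, §6.8.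
* R. E. A. C. Paley, N. Wiener, *Fourier transforms in the complex domain*, AMS Colloq. Publ. 19
  (1934), Thm. X.
-/

noncomputable section

open MeasureTheory Set Filter Complex
open scoped Real Topology ComplexConjugate FourierTransform

namespace Literature.Analysis.Complex

namespace PaleyWienerExpType

variable {F : ℂ → ℂ} {τ : ℝ}

/-! ## A. Stability of the class `IsEntireOfExpTypeLE` -/

/-- The constant in an exponential-type bound is non-negative. [folklore] -/
private theorem const_nonneg {A c : ℝ} (h : ∀ z : ℂ, ‖F z‖ ≤ A * Real.exp (c * ‖z‖)) : 0 ≤ A :=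
  nonneg_of_mul_nonneg_left ((norm_nonneg _).trans (h 0)) (Real.exp_pos _)

/-- Exponential type is stable under translation of the argument. [cite: Boas1954, §2.1] -/
theorem comp_add_const (hF : IsEntireOfExpTypeLE F τ) (hτ : 0 ≤ τ) (c : ℂ) :
    IsEntireOfExpTypeLE (fun z ↦ F (z + c)) τ := by
  refine ⟨hF.1.comp (differentiable_id.add_const c), fun ε hε ↦ ?_⟩
  obtain ⟨A, hA⟩ := hF.2 ε hε
  have hA0 : 0 ≤ A := const_nonneg hA
  refine ⟨A * Real.exp ((τ + ε) * ‖c‖), fun z ↦ (hA (z + c)).trans ?_⟩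
  have hτε : 0 ≤ τ + ε := by linarith
  calc A * Real.exp ((τ + ε) * ‖z + c‖)
      ≤ A * Real.exp ((τ + ε) * (‖z‖ + ‖c‖)) := by
        gcongr
        exact norm_add_le _ _
    _ = A * Real.exp ((τ + ε) * ‖c‖) * Real.exp ((τ + ε) * ‖z‖) := by
        rw [mul_add, Real.exp_add]; ring

/-- Exponential type is stable under `F ↦ F♯`, `F♯(z) = conj F(z̄)`. [cite: Boas1954, §2.1] -/
theorem sharp (hF : IsEntireOfExpTypeLE F τ) :
    IsEntireOfExpTypeLE (fun z ↦ conj (F (conj z))) τ := by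
  refine ⟨fun z ↦ ?_, fun ε hε ↦ ?_⟩
  · have h := (hF.1 (conj z)).conj_conj
    rw [conj_conj] at h
    exact h
  · obtain ⟨A, hA⟩ := hF.2 ε hε
    refine ⟨A, fun z ↦ ?_⟩
    rw [Complex.norm_conj]
    simpa only [Complex.norm_conj] using hA (conj z)

/-! ## B. Plancherel–Pólya at `p = 2` -/

/-- **Plancherel–Pólya on horizontal lines, `p = 2`**: `x ↦ |F(x+iy)|²` is integrable and
`∫ |F(x+iy)|² dx ≤ e^{2τ|y|} ∫ |F(x)|² dx`. [cite: Young2001Nonharmonic, Ch. 2 Thm. 16] -/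
theorem integrable_sq_line (hF : IsEntireOfExpTypeLE F τ) (hτ : 0 ≤ τ)
    (h2 : Integrable fun x : ℝ ↦ ‖F x‖ ^ 2) (y : ℝ) :
    Integrable (fun x : ℝ ↦ ‖F (x + y * I)‖ ^ 2) ∧
      ∫ x : ℝ, ‖F (x + y * I)‖ ^ 2 ≤ Real.exp (2 * τ * |y|) * ∫ x : ℝ, ‖F x‖ ^ 2 := by
  have h2' : Integrable fun x : ℝ ↦ ‖F x‖ ^ (2 : ℝ) := by simpa only [Real.rpow_two] using h2
  have h := Young2001_thm_2_16_PlancherelPolya_holds F τ hτ hF 2 two_pos h2' y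
  simp only [Real.rpow_two] at h
  refine ⟨h.1, ?_⟩
  simpa only [mul_comm (2 : ℝ) τ, mul_assoc] using h.2

/-! ## C. The upper half-plane step: a density supported in `(−τ, ∞)` -/

/-- The auxiliary `H²(ℂ₊)` function `G(z) = F(z − i)·e^{iτz}`: holomorphic on the upper half-plane,
with `∫ |G(x+iy)|² dx ≤ e^{2τ} ∫ |F|²` for every `y > 0`. [cite: Rudin1987, Thm. 19.3 (proof)] -/
theorem hardy_aux (hF : IsEntireOfExpTypeLE F τ) (hτ : 0 ≤ τ)
    (h2 : Integrable fun x : ℝ ↦ ‖F x‖ ^ 2) :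
    DifferentiableOn ℂ (fun z ↦ F (z - I) * cexp (I * τ * z)) {z : ℂ | 0 < z.im} ∧
    (∀ y : ℝ, 0 < y →
      Integrable (fun x : ℝ ↦ ‖(fun z ↦ F (z - I) * cexp (I * τ * z)) (x + y * I)‖ ^ 2)) ∧
    (∀ y : ℝ, 0 < y →
      ∫ x : ℝ, ‖(fun z ↦ F (z - I) * cexp (I * τ * z)) (x + y * I)‖ ^ 2 ≤
        (√(Real.exp (2 * τ) * ∫ x : ℝ, ‖F x‖ ^ 2)) ^ 2) := by
  have hd : Differentiable ℂ (fun z ↦ F (z - I) * cexp (I * τ * z)) :=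
    (hF.1.comp (differentiable_id.sub_const I)).mul (by fun_prop)
  -- the pointwise identity `‖G(x+iy)‖² = e^{-2τy} ‖F(x + (y-1)i)‖²`
  have hpt : ∀ x y : ℝ, ‖F ((x : ℂ) + y * I - I) * cexp (I * τ * ((x : ℂ) + y * I))‖ ^ 2 =
      Real.exp (-(2 * τ * y)) * ‖F (x + (y - 1 : ℝ) * I)‖ ^ 2 := by
    intro x y
    have harg : (x : ℂ) + y * I - I = x + ((y - 1 : ℝ) : ℂ) * I := by push_cast; ring
    have hexp : ‖cexp (I * τ * ((x : ℂ) + y * I))‖ = Real.exp (-(τ * y)) := by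
      rw [Complex.norm_exp]
      congr 1
      simp only [mul_re, mul_im, add_re, add_im, I_re, I_im, ofReal_re, ofReal_im, mul_zero,
        mul_one, zero_mul, sub_zero, zero_add, add_zero, one_mul, zero_sub]
    rw [norm_mul, mul_pow, harg, hexp, ← Real.exp_nat_mul]
    push_cast
    ring_nf
  have hI0 : 0 ≤ ∫ x : ℝ, ‖F x‖ ^ 2 := integral_nonneg fun _ ↦ by positivity
  refine ⟨hd.differentiableOn, fun y hy ↦ ?_, fun y hy ↦ ?_⟩
  · simp only [hpt]
    exact (integrable_sq_line hF hτ h2 (y - 1)).1.const_mul _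
  · simp only [hpt]
    rw [integral_const_mul, Real.sq_sqrt (mul_nonneg (Real.exp_pos _).le hI0)]
    have hPP := (integrable_sq_line hF hτ h2 (y - 1)).2
    have hyb : -(2 * τ * y) + 2 * τ * |y - 1| ≤ 2 * τ := by
      have : |y - 1| ≤ y + 1 := by
        rw [abs_le]; constructor <;> linarith
      nlinarith
    calc Real.exp (-(2 * τ * y)) * ∫ x : ℝ, ‖F (x + (y - 1 : ℝ) * I)‖ ^ 2
        ≤ Real.exp (-(2 * τ * y)) * (Real.exp (2 * τ * |y - 1|) * ∫ x : ℝ, ‖F x‖ ^ 2) := by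
          gcongr
      _ = Real.exp (-(2 * τ * y) + 2 * τ * |y - 1|) * ∫ x : ℝ, ‖F x‖ ^ 2 := by
          rw [Real.exp_add]; ring
      _ ≤ Real.exp (2 * τ) * ∫ x : ℝ, ‖F x‖ ^ 2 := by
          gcongr

/-- The weight `1_{(−τ,∞)}(v) e^{−v}` is bounded by `e^{τ}`. [folklore] -/
private theorem norm_weight_le (τ v : ℝ) :
    ‖(Ioi (-τ)).indicator (fun v : ℝ ↦ ((Real.exp (-v) : ℝ) : ℂ)) v‖ ≤ Real.exp τ := by
  by_cases hv : v ∈ Ioi (-τ)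
  · rw [indicator_of_mem hv, Complex.norm_real, Real.norm_eq_abs, abs_of_pos (Real.exp_pos _),
      Real.exp_le_exp]
    have : -τ < v := hv
    linarith
  · rw [indicator_of_notMem hv, norm_zero]; exact (Real.exp_pos _).le

/-- The weight `1_{(−τ,∞)}(v) e^{−v}` is square integrable. [folklore] -/
private theorem memLp_two_weight (τ : ℝ) :
    MemLp (fun v : ℝ ↦ (Ioi (-τ)).indicator (fun v : ℝ ↦ ((Real.exp (-v) : ℝ) : ℂ)) v) 2 volume := by
  have hmeas : AEStronglyMeasurable
      (fun v : ℝ ↦ (Ioi (-τ)).indicator (fun v : ℝ ↦ ((Real.exp (-v) : ℝ) : ℂ)) v) volume :=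
    (Complex.continuous_ofReal.comp (Real.continuous_exp.comp continuous_neg)).aestronglyMeasurable
      |>.indicator measurableSet_Ioi
  rw [memLp_two_iff_integrable_sq_norm hmeas]
  have hi2 : IntegrableOn (fun v : ℝ ↦ ‖((Real.exp (-v) : ℝ) : ℂ)‖ ^ 2) (Ioi (-τ)) := by
    refine (exp_neg_integrableOn_Ioi (-τ) two_pos).congr_fun (fun v _ ↦ ?_) measurableSet_Ioi
    rw [Complex.norm_real, Real.norm_eq_abs, abs_of_pos (Real.exp_pos _), ← Real.exp_nat_mul]
    push_cast; ring_nf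
  have : (fun v : ℝ ↦ ‖(Ioi (-τ)).indicator (fun v : ℝ ↦ ((Real.exp (-v) : ℝ) : ℂ)) v‖ ^ 2) =
      (Ioi (-τ)).indicator (fun v : ℝ ↦ ‖((Real.exp (-v) : ℝ) : ℂ)‖ ^ 2) := by
    funext v
    by_cases hv : v ∈ Ioi (-τ)
    · rw [indicator_of_mem hv, indicator_of_mem hv]
    · rw [indicator_of_notMem hv, indicator_of_notMem hv, norm_zero, zero_pow two_ne_zero]
  rw [this]
  exact hi2.integrable_indicator measurableSet_Ioi

/-- Translating a set integral over a half-line: `∫_{(−τ,∞)} f(v) dv = ∫_{(0,∞)} f(u − τ) du`.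
[folklore] -/
private theorem setIntegral_Ioi_neg_eq (f : ℝ → ℂ) (τ : ℝ) :
    ∫ v in Ioi (-τ), f v = ∫ u in Ioi (0 : ℝ), f (u - τ) := by
  rw [← integral_indicator measurableSet_Ioi, ← integral_indicator measurableSet_Ioi,
    ← integral_sub_right_eq_self (μ := volume) ((Ioi (-τ)).indicator f) τ]
  congr 1
  funext u
  by_cases hu : u ∈ Ioi (0 : ℝ)
  · have hu' : u - τ ∈ Ioi (-τ) := by
      have : (0 : ℝ) < u := hu
      show -τ < u - τ; linarith
    rw [indicator_of_mem hu', indicator_of_mem hu]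
  · have hu' : u - τ ∉ Ioi (-τ) := by
      intro h
      have : -τ < u - τ := h
      exact hu (show (0 : ℝ) < u by linarith)
    rw [indicator_of_notMem hu', indicator_of_notMem hu]

/-- **Step C.** For `F` entire of exponential type `≤ τ` and square integrable on `ℝ` there is a
density `A ∈ L¹ ∩ L²`, vanishing off `(−τ, ∞)`, with `F(x) = ∫ A(v) e^{ixv} dv` for every real `x`
(namely `A(v) = ψ(v + τ)e^{−v}`, where `ψ ∈ L²(0,∞)` represents `F(z − i)e^{iτz} ∈ H²(ℂ₊)`).
[cite: Rudin1987, Thm. 19.3 (proof) and Thm. 19.2] -/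
theorem exists_density_Ioi (hF : IsEntireOfExpTypeLE F τ) (hτ : 0 ≤ τ)
    (h2 : Integrable fun x : ℝ ↦ ‖F x‖ ^ 2) :
    ∃ A : ℝ → ℂ, Integrable A ∧ MemLp A 2 volume ∧ (∀ v, v ∉ Ioi (-τ) → A v = 0) ∧
      ∀ x : ℝ, F x = ∫ v : ℝ, A v * cexp (I * x * v) := by
  obtain ⟨hd, hint, hM⟩ := hardy_aux hF hτ h2
  obtain ⟨ψ, hψ2, -, -, hψG⟩ :=
    Literature.Analysis.DeBrangesSpaces.exists_halfLine_laplace_of_hardy hd hint hM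
      (Real.sqrt_nonneg _)
  -- the weight and the density
  set w : ℝ → ℂ := fun v ↦ (Ioi (-τ)).indicator (fun v : ℝ ↦ ((Real.exp (-v) : ℝ) : ℂ)) v
    with hwdef
  set A : ℝ → ℂ := fun v ↦ ψ (v + τ) * w v with hAdef
  have hψτ : MemLp (fun v : ℝ ↦ ψ (v + τ)) 2 volume :=
    hψ2.comp_measurePreserving (measurePreserving_add_right volume τ)
  have hw2 : MemLp w 2 volume := memLp_two_weight τ
  have hA1 : Integrable A := hψτ.integrable_mul hw2
  have hAmeas : AEStronglyMeasurable A volume := hA1.aestronglyMeasurable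
  have hA2 : MemLp A 2 volume := by
    rw [memLp_two_iff_integrable_sq_norm hAmeas]
    have hψτ2 : Integrable fun v : ℝ ↦ ‖ψ (v + τ)‖ ^ 2 :=
      (memLp_two_iff_integrable_sq_norm hψτ.1).1 hψτ
    refine (hψτ2.const_mul (Real.exp τ ^ 2)).mono' (hAmeas.norm.pow 2) ?_
    refine Eventually.of_forall fun v ↦ ?_
    rw [Real.norm_eq_abs, abs_of_nonneg (by positivity), hAdef]
    simp only [norm_mul, mul_pow]
    have hwv : ‖w v‖ ≤ Real.exp τ := norm_weight_le τ v
    have : ‖w v‖ ^ 2 ≤ Real.exp τ ^ 2 := by gcongr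
    calc ‖ψ (v + τ)‖ ^ 2 * ‖w v‖ ^ 2 ≤ ‖ψ (v + τ)‖ ^ 2 * Real.exp τ ^ 2 := by gcongr
      _ = Real.exp τ ^ 2 * ‖ψ (v + τ)‖ ^ 2 := by ring
  refine ⟨A, hA1, hA2, fun v hv ↦ by simp [hAdef, hwdef, indicator_of_notMem hv], fun x ↦ ?_⟩
  -- the representation at `w = x + i`
  have him : 0 < ((x : ℂ) + I).im := by simp
  have hG := hψG ((x : ℂ) + I) him
  simp only [add_sub_cancel_right] at hG
  -- `∫ A(v) e^{ixv} dv = e^{τ - iτx} ∫₀^∞ ψ(u) e^{i(x+i)u} du`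
  have hexp_id : ∀ u : ℝ, ((Real.exp (-(u - τ)) : ℝ) : ℂ) * cexp (I * x * ((u - τ : ℝ) : ℂ)) =
      cexp (τ - I * τ * x) * cexp (I * ((x : ℂ) + I) * u) := by
    intro u
    rw [Complex.ofReal_exp, ← Complex.exp_add, ← Complex.exp_add]
    congr 1
    push_cast
    ring_nf
    rw [I_sq]
    ring
  have h1 : ∫ v : ℝ, A v * cexp (I * x * v) =
      ∫ v in Ioi (-τ), ψ (v + τ) * ((Real.exp (-v) : ℝ) : ℂ) * cexp (I * x * v) := by
    rw [← integral_indicator measurableSet_Ioi]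
    congr 1
    funext v
    simp only [hAdef, hwdef]
    by_cases hv : v ∈ Ioi (-τ)
    · rw [indicator_of_mem hv, indicator_of_mem hv]
    · rw [indicator_of_notMem hv, indicator_of_notMem hv, mul_zero, zero_mul]
  have h2' : ∫ v in Ioi (-τ), ψ (v + τ) * ((Real.exp (-v) : ℝ) : ℂ) * cexp (I * x * v) =
      ∫ u in Ioi (0 : ℝ), ψ u * (cexp (τ - I * τ * x) * cexp (I * ((x : ℂ) + I) * u)) := by
    rw [setIntegral_Ioi_neg_eq]
    refine setIntegral_congr_fun measurableSet_Ioi fun u _ ↦ ?_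
    simp only [sub_add_cancel]
    rw [mul_assoc, ← hexp_id u]
  have h3 : ∫ u in Ioi (0 : ℝ), ψ u * (cexp (τ - I * τ * x) * cexp (I * ((x : ℂ) + I) * u)) =
      cexp (τ - I * τ * x) * ∫ u in Ioi (0 : ℝ), ψ u * cexp (I * ((x : ℂ) + I) * u) := by
    rw [← integral_const_mul]
    refine setIntegral_congr_fun measurableSet_Ioi fun u _ ↦ ?_
    ring
  rw [h1, h2', h3, hG, ← mul_assoc, mul_comm (cexp _) (F x), mul_assoc, ← Complex.exp_add]
  have : (τ : ℂ) - I * τ * x + I * τ * ((x : ℂ) + I) = 0 := by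
    ring_nf; rw [I_sq]; ring
  rw [this, Complex.exp_zero, mul_one]

/-! ## D. The lower half-plane step, by conjugation: a density supported in `(−∞, τ)` -/

/-- **Step D.** Applying Step C to `F♯(z) = conj F(z̄)` and conjugating back: a density
`C ∈ L¹ ∩ L²` vanishing off `(−∞, τ)` with `F(x) = ∫ C(u) e^{ixu} du` for every real `x`.
[cite: Rudin1987, Thm. 19.3 (proof)] -/
theorem exists_density_Iio (hF : IsEntireOfExpTypeLE F τ) (hτ : 0 ≤ τ)
    (h2 : Integrable fun x : ℝ ↦ ‖F x‖ ^ 2) :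
    ∃ C : ℝ → ℂ, Integrable C ∧ MemLp C 2 volume ∧ (∀ u, u ∉ Iio τ → C u = 0) ∧
      ∀ x : ℝ, F x = ∫ u : ℝ, C u * cexp (I * x * u) := by
  have h2' : Integrable fun x : ℝ ↦ ‖(fun z ↦ conj (F (conj z))) x‖ ^ 2 := by
    simpa only [Complex.conj_ofReal, Complex.norm_conj] using h2
  obtain ⟨B, hB1, hB2, hB0, hBF⟩ := exists_density_Ioi (sharp hF) hτ h2'
  set C : ℝ → ℂ := fun u ↦ conj (B (-u)) with hCdef
  have hBn1 : Integrable (fun u : ℝ ↦ B (-u)) := hB1.comp_neg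
  have hBn2 : MemLp (fun u : ℝ ↦ B (-u)) 2 volume :=
    hB2.comp_measurePreserving (Measure.measurePreserving_neg volume)
  have hCmeas : AEStronglyMeasurable C volume :=
    Complex.continuous_conj.comp_aestronglyMeasurable hBn1.aestronglyMeasurable
  have hC1 : Integrable C := by
    have := Complex.conjCLE.toContinuousLinearMap.integrable_comp hBn1
    simpa using this
  have hC2 : MemLp C 2 volume :=
    MemLp.of_le hBn2 hCmeas (Eventually.of_forall fun u ↦ by simp [hCdef])
  refine ⟨C, hC1, hC2, fun u hu ↦ ?_, fun x ↦ ?_⟩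
  · have : -u ∉ Ioi (-τ) := by
      intro h
      have h' : -τ < -u := h
      exact hu (show u < τ by linarith)
    simp [hCdef, hB0 _ this]
  · have h := hBF x
    simp only [Complex.conj_ofReal] at h
    -- `F x = conj ∫ B(v) e^{ixv} dv = ∫ conj B(v) e^{-ixv} dv = ∫ conj B(-u) e^{ixu} du`
    have h1 : F x = conj (∫ v : ℝ, B v * cexp (I * x * v)) := by
      rw [← h, conj_conj]
    rw [h1, ← integral_conj, ← integral_neg_eq_self (fun u : ℝ ↦ C u * cexp (I * x * u)) volume]
    congr 1
    funext v
    simp only [hCdef, neg_neg, map_mul, ← Complex.exp_conj, map_mul, Complex.conj_I,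
      Complex.conj_ofReal]
    push_cast
    ring_nf

/-! ## E. Uniqueness: the two densities coincide, so the density lives on `[−τ, τ]` -/

/-- `∫ D(v) e^{ixv} dv` is the Fourier transform of `D` at `−x/2π`; if it vanishes for all real `x`
then `𝓕 D = 0`. [folklore] -/
private theorem fourier_eq_zero_of_forall_integral_eq_zero {D : ℝ → ℂ}
    (h : ∀ x : ℝ, ∫ v : ℝ, D v * cexp (I * x * v) = 0) (ξ : ℝ) : 𝓕 D ξ = 0 := by
  rw [Real.fourier_real_eq_integral_exp_smul]
  have := h (-2 * π * ξ)
  rw [← this]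
  congr 1
  funext v
  rw [smul_eq_mul, mul_comm]
  congr 1
  push_cast
  ring_nf

/-- **Step E.** The density of an entire function of exponential type `≤ τ`, square integrable on
`ℝ`: `φ ∈ L¹ ∩ L²` vanishing off `[−τ, τ]` with `F(x) = ∫ φ(u)e^{ixu} du` on the real axis.
[cite: Rudin1987, Thm. 19.3] -/
theorem exists_density_Icc (hF : IsEntireOfExpTypeLE F τ) (hτ : 0 ≤ τ)
    (h2 : Integrable fun x : ℝ ↦ ‖F x‖ ^ 2) :
    ∃ φ : ℝ → ℂ, Integrable φ ∧ MemLp φ 2 volume ∧ (∀ u, u ∉ Icc (-τ) τ → φ u = 0) ∧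
      ∀ x : ℝ, F x = ∫ u : ℝ, φ u * cexp (I * x * u) := by
  obtain ⟨A, hA1, hA2, hA0, hAF⟩ := exists_density_Ioi hF hτ h2
  obtain ⟨C, hC1, hC2, hC0, hCF⟩ := exists_density_Iio hF hτ h2
  -- `A = C` a.e.
  have hint : ∀ x : ℝ, Integrable fun v : ℝ ↦ A v * cexp (I * x * v) := by
    intro x
    refine hA1.mul_bdd (c := 1) (by fun_prop) (Eventually.of_forall fun v ↦ ?_)
    rw [Complex.norm_exp]
    have : (I * x * v).re = 0 := by simp
    rw [this, Real.exp_zero]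
  have hintC : ∀ x : ℝ, Integrable fun v : ℝ ↦ C v * cexp (I * x * v) := by
    intro x
    refine hC1.mul_bdd (c := 1) (by fun_prop) (Eventually.of_forall fun v ↦ ?_)
    rw [Complex.norm_exp]
    have : (I * x * v).re = 0 := by simp
    rw [this, Real.exp_zero]
  have hD : ∀ x : ℝ, ∫ v : ℝ, (A - C) v * cexp (I * x * v) = 0 := by
    intro x
    have : (fun v : ℝ ↦ (A - C) v * cexp (I * x * v)) =
        fun v ↦ A v * cexp (I * x * v) - C v * cexp (I * x * v) := by
      funext v; simp only [Pi.sub_apply]; ring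
    rw [this, integral_sub (hint x) (hintC x), ← hAF x, ← hCF x, sub_self]
  have hAC : A =ᵐ[volume] C := by
    have := Literature.Analysis.Fourier.ae_eq_zero_of_forall_fourier_eq_zero (hA1.sub hC1)
      (fourier_eq_zero_of_forall_integral_eq_zero hD)
    filter_upwards [this] with v hv
    exact sub_eq_zero.1 hv
  -- the density `φ = 1_{[−τ,τ]} A`
  set φ : ℝ → ℂ := (Icc (-τ) τ).indicator A with hφdef
  have hφA : φ =ᵐ[volume] A := by
    filter_upwards [hAC] with v hv
    by_cases hv' : v ∈ Icc (-τ) τ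
    · rw [hφdef, indicator_of_mem hv']
    · rw [hφdef, indicator_of_notMem hv']
      rw [mem_Icc, not_and_or, not_le, not_le] at hv'
      rcases hv' with hlt | hgt
      · exact (hA0 v (fun h ↦ (lt_irrefl _ ((show -τ < v from h).trans hlt)).elim)).symm
      · rw [hv]
        exact (hC0 v (fun h ↦ (lt_irrefl _ ((show v < τ from h).trans hgt)).elim)).symm
  refine ⟨φ, hA1.congr hφA.symm, hA2.ae_eq hφA.symm, fun u hu ↦ ?_, fun x ↦ ?_⟩
  · rw [hφdef, indicator_of_notMem hu]
  · rw [hAF x]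
    refine integral_congr_ae ?_
    filter_upwards [hφA] with v hv
    rw [hv]

/-! ## F. Extension from the real axis to `ℂ` -/

/-- The Fourier–Laplace integral `z ↦ ∫ φ(u) e^{izu} du` of an integrable `φ` supported in
`[−R, R]` is entire (the tree's `differentiable_fourierLaplace`, after the substitution
`u = −2πv`; the elementary direction of the Paley–Wiener theorem). [cite: Rudin1987, Thm. 19.3] -/
theorem differentiable_laplace {φ : ℝ → ℂ} {R : ℝ} (hφ : Integrable φ) (hR : 0 ≤ R)
    (h0 : ∀ u, u ∉ Icc (-R) R → φ u = 0) :
    Differentiable ℂ fun z : ℂ ↦ ∫ u : ℝ, φ u * cexp (I * z * u) := by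
  -- `ψ(v) := 2π φ(−2πv)` is integrable, supported in `[−R/2π, R/2π]`
  set ψ : ℝ → ℂ := fun v ↦ (2 * π : ℂ) * φ (-(2 * π) * v) with hψdef
  have h2π0 : (-(2 * π) : ℝ) ≠ 0 := neg_ne_zero.2 (by positivity)
  have hψ : Integrable ψ := (hφ.comp_mul_left' h2π0).const_mul _
  have hR' : 0 ≤ R / (2 * π) := by positivity
  have hψ0 : ∀ v, v ∉ Icc (-(R / (2 * π))) (R / (2 * π)) → ψ v = 0 := by
    intro v hv
    have : -(2 * π) * v ∉ Icc (-R) R := by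
      intro h
      apply hv
      rw [mem_Icc] at h ⊢
      constructor
      · rw [neg_le, le_div_iff₀ (by positivity)]; linarith [h.2]
      · rw [le_div_iff₀ (by positivity)]; linarith [h.1]
    show (2 * π : ℂ) * φ (-(2 * π) * v) = 0
    rw [h0 _ this, mul_zero]
  have hd := Literature.Analysis.Fourier.differentiable_fourierLaplace hψ hR' hψ0
  -- the two integrals agree
  have heq : (fun z : ℂ ↦ ∫ u : ℝ, φ u * cexp (I * z * u)) =
      fun z ↦ ∫ v : ℝ, cexp (((-(2 * π * v) : ℝ) : ℂ) * z * I) * ψ v := by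
    funext z
    have hsub := Measure.integral_comp_mul_left (fun u : ℝ ↦ φ u * cexp (I * z * u)) (-(2 * π))
    -- `∫ φ(-2πv) e^{iz(-2πv)} dv = |(-2π)⁻¹| ∫ φ(u) e^{izu} du`
    have habs : |(-(2 * π) : ℝ)⁻¹| = (2 * π)⁻¹ := by
      rw [abs_inv, abs_neg, abs_of_pos (by positivity)]
    rw [habs] at hsub
    have h2π : (2 * π : ℝ) ≠ 0 := by positivity
    calc ∫ u : ℝ, φ u * cexp (I * z * u)
        = (2 * π : ℝ) • ((2 * π : ℝ)⁻¹ • ∫ u : ℝ, φ u * cexp (I * z * u)) := by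
          rw [smul_smul, mul_inv_cancel₀ h2π, one_smul]
      _ = (2 * π : ℝ) • ∫ v : ℝ, φ (-(2 * π) * v) * cexp (I * z * ((-(2 * π) * v : ℝ) : ℂ)) := by
          rw [← hsub]
      _ = ∫ v : ℝ, cexp (((-(2 * π * v) : ℝ) : ℂ) * z * I) * ψ v := by
          rw [← integral_smul]
          congr 1
          funext v
          simp only [hψdef, Complex.real_smul]
          push_cast
          ring_nf
  rw [heq]
  exact hd

/-- Identity theorem: two entire functions agreeing on `ℝ` agree everywhere (a set with a limit
point). [cite: Rudin1987, Thm. 10.18] -/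
theorem entire_eq_of_eqOn_real {f g : ℂ → ℂ} (hf : Differentiable ℂ f) (hg : Differentiable ℂ g)
    (h : ∀ t : ℝ, f t = g t) : f = g := by
  refine AnalyticOnNhd.eq_of_frequently_eq (z₀ := 0) (fun z _ ↦ hf.analyticAt z)
    (fun z _ ↦ hg.analyticAt z) ?_
  have ht : Tendsto (fun t : ℝ ↦ (t : ℂ)) (𝓝[≠] 0) (𝓝[≠] 0) :=
    tendsto_nhdsWithin_of_tendsto_nhds_of_eventually_within _
      ((Complex.continuous_ofReal.tendsto' 0 0 Complex.ofReal_zero).mono_left nhdsWithin_le_nhds)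
      (eventually_mem_nhdsWithin.mono fun t ht ↦ by simpa using ht)
  exact ht.frequently (Frequently.of_forall h)

end PaleyWienerExpType

open PaleyWienerExpType in
/-- **The Paley–Wiener theorem.** An entire function `F` of exponential type at most `τ ≥ 0`
which is square integrable on the real axis is the Fourier–Laplace transform of a function
`φ ∈ L¹ ∩ L²(ℝ)` vanishing off `[−τ, τ]`: `F(z) = ∫ φ(u) e^{izu} du` for every `z ∈ ℂ`.
[cite: Rudin1987, Thm. 19.3] [cite: Young2001Nonharmonic, Ch. 2 Thm. 18] -/
theorem paleyWiener_of_isEntireOfExpTypeLE {F : ℂ → ℂ} {τ : ℝ} (hτ : 0 ≤ τ)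
    (hF : IsEntireOfExpTypeLE F τ) (h2 : Integrable fun x : ℝ ↦ ‖F x‖ ^ 2) :
    ∃ φ : ℝ → ℂ, Integrable φ ∧ MemLp φ 2 volume ∧ (∀ u, u ∉ Icc (-τ) τ → φ u = 0) ∧
      ∀ z : ℂ, F z = ∫ u : ℝ, φ u * cexp (I * z * u) := by
  obtain ⟨φ, hφ1, hφ2, hφ0, hφF⟩ := exists_density_Icc hF hτ h2
  refine ⟨φ, hφ1, hφ2, hφ0, fun z ↦ ?_⟩
  have h := entire_eq_of_eqOn_real hF.1 (differentiable_laplace hφ1 hτ hφ0) hφF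
  exact congrFun h z

open PaleyWienerExpType in
/-- **The Paley–Wiener theorem**, with the integral over `[−τ, τ]`:
`F(z) = ∫_{[−τ,τ]} φ(u) e^{izu} du` for every `z ∈ ℂ`, `φ ∈ L²`.
[cite: Rudin1987, Thm. 19.3] [cite: Boas1954, §6.8] -/
theorem paleyWiener_of_isEntireOfExpTypeLE' {F : ℂ → ℂ} {τ : ℝ} (hτ : 0 ≤ τ)
    (hF : IsEntireOfExpTypeLE F τ) (h2 : Integrable fun x : ℝ ↦ ‖F x‖ ^ 2) :
    ∃ φ : ℝ → ℂ, MemLp φ 2 volume ∧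
      ∀ z : ℂ, F z = ∫ u in Icc (-τ) τ, φ u * cexp (I * z * u) := by
  obtain ⟨φ, hφ1, hφ2, hφ0, hφF⟩ := paleyWiener_of_isEntireOfExpTypeLE hτ hF h2
  refine ⟨φ, hφ2, fun z ↦ ?_⟩
  rw [hφF z, ← integral_indicator measurableSet_Icc]
  congr 1
  funext u
  by_cases hu : u ∈ Icc (-τ) τ
  · rw [indicator_of_mem hu]
  · rw [indicator_of_notMem hu, hφ0 u hu, zero_mul]

end Literature.Analysis.Complex
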